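/-
Copyright (c) 2026 the pub-hodgecm-mathlib formalisation cell (harness21).  R90-TF SLAB, section S6 «Ch14.1–5 stable TF» (Rogawski 1990, §3.5–§3.6: local classes inside a
stable class), prover K2E3-p17 (g12); CARD «CLASSIFY-C1» (S6 dealer R90-C14-plan (g3), R90 bus 2026-09-05T03:37:14Z; spec = K2E3-p11 (g11) CENSUS «CLASSIFY» §C1, 03:30:00Z);
h413 = `stmt-HodgeConjecture-24833`, route `HCCMUnconditional`.
-/
import Literature.NumberTheory.Rogawski1990.LocalStableClassesNonsplitRankTwo        -- ★ two classes (element form), the norm-test criterion, `twistGram` frame algebra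
import Literature.NumberTheory.Rogawski1990.LocalStableClassesNonsplitTypeOneOfCharpoly  -- ★ `exists_eigenframe_of_charpoly_eq_prod`
import HarnessLib

/-!
# R90-TF ∕ S6 — CLASSIFY-C1: the `G`-regular type-(1) cell of `U(Φ₂)_v` — `δ_1(a,c)` and `δ_ϖ(a,c)` ARE the two `U(Φ₂)(F_v)`-classes of the stable class
# with eigenvalues `a ≠ c ∈ E¹_v` (`Theorems/R90S6GRegularCellsU2TypeOne.lean`; ns `Summit.HodgeConjecture.HodgeConjecture.R90.S6`; THEOREMS ONLY, ★-only imports, 0 `sorry`)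

WHAT (G5) NEEDS (K2E3-p11 (g11) census «CLASSIFY», the SPEC AUTHORITY for C0∕C2 and the CM dress): both sides of `isLocalDeltaTransfer_iff`'s clause are class functions of
`γ_H = (g, u)` under `H_v`, so for a `G`-regular `γ_H` the assembler conjugates `g` INSIDE `U(Φ₂)_v` to the literal the (E1) cell head is keyed to.  THIS FILE is the
(ELL-1) cell: `g ∈ U(Φ₂)_v` with `χ_g = (X − a)(X − c)`, `a ≠ c ∈ E¹_v` ⇒ `g ∼ δ_1(a,c)` or `g ∼ δ_ϖ(a,c)` in `U(Φ₂)_v`, where (typ1 (E1) v2.3 `hδ₁ ∕ hδ₂` bytes, `e = 2⁻¹`)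
`δ_θ(a,c) = !![e(a+c), −e(a−c)θ; −e(a−c)θ⁻¹, e(a+c)]`, `θ ∈ {1, ϖ}`, and `δ_ϖ` IS the other class: stably conjugate, NOT conjugate.

THE PRINT.  [Rogawski1990 §3.5 Prop. 3.5.2 (c) p. 29]: the conjugacy classes within the stable class of a regular `γ` with `Z(γ) = T` are a principal homogeneous space under
`𝔇(T∕F) = ker(H¹(F, T) → H¹(F, G))`, of order `2^{r−1}` for `T ≅ (E¹)^r` at a non-split `p`-adic place; [§3.6 p. 31]: the tori of `U(2)`; [Flicker1998UnitaryFL §6 p. 95]: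
the explicit representatives `t_1`, `t_ϖ`.  For `r = 2`: TWO classes, told apart by ONE norm test on an eigenline length (★ `exists_unitary_conj_iff_forall_normTest_iff_rankTwo`),
here `⟨p₀, p₀⟩_{Φ₂} = −2` for the `a`-eigenline `p₀ = (1, −1)` of `δ_1` versus `⟨D p₀, D p₀⟩_{Φ₂} = −2ϖ` for `δ_ϖ = D δ_1 D⁻¹`, `D = diag(ϖ, 1)`, and `ϖ ∉ N(E_v^×)`
[Omeara1963 §63C Ex. 63:16: at an unramified inert place the norms are the elements of even order].

CURRENCY = the ★ bricks' (p11 census ROAD): `E∕F` quadratic number fields, `v : HeightOneSpectrum (𝓞 F)`, `τ : E ≃ₐ[F] E` with `τ δ = −δ`, `δ ≠ 0`, a place `w ∣ v` fixed by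
`τ` (non-split `v`), matrices over `E_v = LocalRing E v` (a field, ★ `isField_localRing_of_nonsplit`), `σ = conjLocal E τ v`, `U(H) = unitaryGroup σ H ≤ GL₂(E_v)`,
`IsStablyConj σ H` (★ `StableConjugacyU3`: ambient `GL₂`-conjugacy), Mathlib `IsConj` on `↥U(H)`, `twistGram σ H M = ᵗ(σM) H M` (★ `CartanInvariant`).
* §1 (generic hermitian `H`, unit determinant): `isStablyConj_not_isConj_forall_of_not_normTest` — ANY explicit stable conjugate `D γ D⁻¹ ∈ U(H)` whose transported eigenframe
  FAILS norm test 0 IS the second class (stably conjugate, not conjugate, and with `γ` exhaustive), from ★ `exists_isStablyConj_not_isConj_forall_isConj_or_rankTwo` (two classes)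
  + ★ the criterion at `(g, g′) = (1, D)`; `isConj_or_isConj_of_charpoly_eq` — the same for every `g ∈ U(H)` with `χ_g = ∏ (X − uᵢ)` (★ `exists_eigenframe_of_charpoly_eq_prod`).
* §2 (any commutative ring `R`, involution-free literal algebra): the frame `P₀ = !![1, 1; −1, 1]` and `D = diag(ϖ, 1)` as `GL₂` elements (existence theorems, no `def`),
  `δ_1 P₀ = P₀ diag(a, c)`, `D δ_1 D⁻¹ = δ_ϖ`, the two Gram entries `−2`, `−2ϖ`, and «`−2ϖ = N(z)(−2)` ⇒ `ϖ = N(z)`» (`2e = 1`).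
* §3 THE HEADS at `Φ₂ = Matrix.of fun i j : Fin 2 => if i.val + j.val + 1 = 2 then 1 else 0` (the tree's antidiagonal spelling, `= !![0, 1; 1, 0]`) (hermitian, `det = −1`), literals and memberships HYPOTHESIS-FIRST exactly as typ1 (E1) v2.3 :207–:208 read in `E_v` (membership of
  `δ_θ` in `U₂` stays typ1's (W3) `fin_cases`; NO import of C0): `isStablyConj_not_isConj_forall_deltaOne_deltaVarpi` (the pair) and **`isConj_deltaOne_or_deltaVarpi_of_charpoly`**
  (the (ELL-1) cell head) + its CONJUGATOR FORM `exists_mem_conj_eq_deltaOne_or_deltaVarpi_of_charpoly` (`∃ h ∈ U(Φ₂)(F_v), h g h⁻¹ = δ_1 ∨ h g h⁻¹ = δ_ϖ`; spec (P2)).  The ONE external input is `hϖN : ¬ ∃ z, IsUnit z ∧ ϖ = σ z * z` BY VALUE — at an inert unramified `v` every uniformiser of `F_v` qualifies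
  (★ `mem_quadraticNormSubgroup_iff_even_of_isUnramifiedIn`, in `(v.adicCompletion F)ˣ` currency); the seam `LocalRing E v ≃+* E_w` (★ `LocalRing.evalEquiv`) is the CM dress's,
  like `h2e` and the uniformiser letter `hdw`.
HONEST LABEL: count-neutral paydown of the (E1) cell's G-side classification; pays no socket by itself; HC_CM is proved only modulo the 7 printed citations (2 remaining named
inputs: hLiu418 = `stmt-HodgeConjecture-24832`, h413 = `stmt-HodgeConjecture-24833`) until rung 0 closes; REL ≠ ★ ≠ BUILT.

## References
* [Rogawski1990] J. D. Rogawski, *Automorphic Representations of Unitary Groups in Three Variables*, Ann. of Math. Stud. 123 (1990): §3.5 Prop. 3.5.2 (a)(c) p. 29; §3.6 p. 31;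
  §3.1 p. 19; §4.9 p. 54 (`H = U(2) × U(1)`).
* [Flicker1998UnitaryFL] Y. Z. Flicker, *Elementary proof of the fundamental lemma for a unitary group*, Canad. J. Math. 50 (1998), §6 p. 95 (`t_1`, `t_ϖ`).
* [Omeara1963] O. T. O'Meara, *Introduction to Quadratic Forms* (1963), §63C Example 63:16.
* [HornJohnson2013] R. A. Horn, C. R. Johnson, *Matrix Analysis*, 2nd ed. (2013), 3.3.P12 (non-derogatory matrices with equal characteristic polynomial are similar).
-/

set_option autoImplicit false
set_option linter.dupNamespace false

noncomputable section

open Matrix NumberField IsDedekindDomain Polynomial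
open scoped MatrixGroups

namespace Summit.HodgeConjecture.HodgeConjecture.R90.S6

open Literature.NumberTheory.Rogawski1990
open Literature.NumberTheory.Automorphic Literature.NumberTheory.Automorphic.UnitaryGroup Literature.NumberTheory.QuadraticForms
open Literature.AlgebraicGeometry.ShimuraVarieties (unitaryGroup mem_unitaryGroup_iff)

section Generic

variable {F : Type} (E : Type) [Field F] [NumberField F] [Field E] [NumberField E] [Algebra F E]
  [Algebra.IsQuadraticExtension F E] (v : HeightOneSpectrum (𝓞 F)) (c : E ≃ₐ[F] E) {δ : E} (hcδ : c δ = -δ) (hδ : δ ≠ 0)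
  {H : Matrix (Fin 2) (Fin 2) (LocalRing E v)} {γ P : GL (Fin 2) (LocalRing E v)} {u : Fin 2 → LocalRing E v}

include hcδ hδ in
/-- **§1 (generic `H`) — AN EXPLICIT STABLE CONJUGATE FAILING NORM TEST 0 IS THE SECOND CLASS.**  Rank 2, non-split `v`, `γ ∈ U(H)(F_v)` with eigenframe `P` and
distinct norm-one eigenvalues `u` (type (1), `Z(γ) ≅ E¹ × E¹`): if `D ∈ GL₂(E_v)` conjugates `γ` into `U(H)(F_v)` and the transported frame `D P` FAILS the norm test
«`⟨D p₀, D p₀⟩_H ∈ N(E_v^×) · ⟨p₀, p₀⟩_H`», then `D γ D⁻¹` is stably conjugate and NOT conjugate to `γ`, and every element of `U(H)(F_v)` stably conjugate to `γ` is conjugate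
to `γ` or to `D γ D⁻¹` (★ `exists_isStablyConj_not_isConj_forall_isConj_or_rankTwo`: the stable class has exactly two classes; ★ `exists_unitary_conj_iff_forall_normTest_iff_rankTwo`
at `g := 1`, `g′ := D`: `γ ≁ D γ D⁻¹` because the frame `P` itself passes test 0 with `z = 1`). [cite: Rogawski1990, §3.5 Prop. 3.5.2 (c) p. 29; §3.6 p. 31]
[cite: Flicker1998UnitaryFL, §6 p. 95] -/
theorem isStablyConj_not_isConj_forall_of_not_normTest (w : PlacesOver E v) (hw : c • w.1 = w.1)
    (hH : (H.map (conjLocal E c v))ᵀ = H) (hHd : IsUnit H.det) (hγ : γ ∈ unitaryGroup (conjLocal E c v) H)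
    (hP : γ.val * P.val = P.val * diagonal u) (hu : Function.Injective u) (hu1 : ∀ i, conjLocal E c v (u i) * u i = 1)
    {D : GL (Fin 2) (LocalRing E v)} (hD : D * γ * D⁻¹ ∈ unitaryGroup (conjLocal E c v) H)
    (hT : ¬ ∃ z : LocalRing E v, IsUnit z ∧ twistGram (conjLocal E c v) H (D.val * P.val) 0 0 =
        conjLocal E c v z * z * twistGram (conjLocal E c v) H P.val 0 0) :
    IsStablyConj (conjLocal E c v) H ⟨γ, hγ⟩ ⟨D * γ * D⁻¹, hD⟩ ∧
      ¬ IsConj (⟨γ, hγ⟩ : unitaryGroup (conjLocal E c v) H) ⟨D * γ * D⁻¹, hD⟩ ∧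
      ∀ δ' : unitaryGroup (conjLocal E c v) H, IsStablyConj (conjLocal E c v) H ⟨γ, hγ⟩ δ' →
        IsConj (⟨γ, hγ⟩ : unitaryGroup (conjLocal E c v) H) δ' ∨ IsConj (⟨D * γ * D⁻¹, hD⟩ : unitaryGroup (conjLocal E c v) H) δ' := by
  have hst : IsStablyConj (conjLocal E c v) H ⟨γ, hγ⟩ ⟨D * γ * D⁻¹, hD⟩ := isStablyConj_iff.2 ⟨D, rfl⟩
  -- `γ` itself, as the stable conjugate by `1`, passes norm test 0 with `z = 1`
  have h1U : (1 : GL (Fin 2) (LocalRing E v)) * γ * 1⁻¹ ∈ unitaryGroup (conjLocal E c v) H := by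
    rw [one_mul, inv_one, mul_one]; exact hγ
  have hT1 : ∃ z : LocalRing E v, IsUnit z ∧ twistGram (conjLocal E c v) H ((1 : GL (Fin 2) (LocalRing E v)).val * P.val) 0 0 =
      conjLocal E c v z * z * twistGram (conjLocal E c v) H P.val 0 0 :=
    ⟨1, isUnit_one, by rw [Units.val_one, Matrix.one_mul, map_one, one_mul, one_mul]⟩
  have hnot : ¬ IsConj (⟨γ, hγ⟩ : unitaryGroup (conjLocal E c v) H) ⟨D * γ * D⁻¹, hD⟩ := by
    intro h
    rw [isConj_iff] at h
    obtain ⟨w', hw'⟩ := h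
    have hconj : ∃ w'' : GL (Fin 2) (LocalRing E v), w'' ∈ unitaryGroup (conjLocal E c v) H ∧
        w'' * (1 * γ * 1⁻¹) * w''⁻¹ = D * γ * D⁻¹ :=
      ⟨w'.val, w'.2, by rw [one_mul, inv_one, mul_one]; exact congrArg Subtype.val hw'⟩
    rw [exists_unitary_conj_iff_forall_normTest_iff_rankTwo E v c hcδ hδ w hw hH hHd hγ hP hu hu1 h1U hD] at hconj
    exact hT ((hconj 0).2 hT1)
  refine ⟨hst, hnot, fun δ' hδ' => ?_⟩
  obtain ⟨g₁, hg₁, -, -, hne, hall⟩ := exists_isStablyConj_not_isConj_forall_isConj_or_rankTwo E v c hcδ hδ w hw hH hHd hγ hP hu hu1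
  -- the explicit second class is conjugate to ★'s second class `g₁ γ g₁⁻¹`
  have hD' : IsConj (⟨g₁ * γ * g₁⁻¹, hg₁⟩ : unitaryGroup (conjLocal E c v) H) ⟨D * γ * D⁻¹, hD⟩ := by
    rcases hall ⟨D * γ * D⁻¹, hD⟩ hst with h | h
    · exact absurd h hnot
    · exact h
  rcases hall δ' hδ' with h | h
  · exact Or.inl h
  · exact Or.inr (hD'.symm.trans h)

include hcδ hδ in
/-- **§1, characteristic-polynomial form**: with `γ`, `D` as above, every `g ∈ U(H)(F_v)` whose characteristic polynomial is `(X − u₀)(X − u₁)` is conjugate IN `U(H)(F_v)` to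
`γ` or to `D γ D⁻¹` (an eigenframe of `g` by ★ `exists_eigenframe_of_charpoly_eq_prod`, whence `g` is stably conjugate to `γ`). [cite: Rogawski1990, §3.5 Prop. 3.5.2 (c) p. 29; §3.6 p. 31]
[cite: HornJohnson2013, 3.3.P12] -/
theorem isConj_or_isConj_of_charpoly_eq (w : PlacesOver E v) (hw : c • w.1 = w.1)
    (hH : (H.map (conjLocal E c v))ᵀ = H) (hHd : IsUnit H.det) (hγ : γ ∈ unitaryGroup (conjLocal E c v) H)
    (hP : γ.val * P.val = P.val * diagonal u) (hu : Function.Injective u) (hu1 : ∀ i, conjLocal E c v (u i) * u i = 1)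
    {D : GL (Fin 2) (LocalRing E v)} (hD : D * γ * D⁻¹ ∈ unitaryGroup (conjLocal E c v) H)
    (hT : ¬ ∃ z : LocalRing E v, IsUnit z ∧ twistGram (conjLocal E c v) H (D.val * P.val) 0 0 =
        conjLocal E c v z * z * twistGram (conjLocal E c v) H P.val 0 0)
    {g : GL (Fin 2) (LocalRing E v)} (hg : g ∈ unitaryGroup (conjLocal E c v) H) (hχ : g.val.charpoly = ∏ i, (X - C (u i))) :
    IsConj (⟨γ, hγ⟩ : unitaryGroup (conjLocal E c v) H) ⟨g, hg⟩ ∨ IsConj (⟨D * γ * D⁻¹, hD⟩ : unitaryGroup (conjLocal E c v) H) ⟨g, hg⟩ := by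
  letI : Field (LocalRing E v) :=
    (Liu2021.LemD1IndexedNonVacuityNonsplitPlace.isField_localRing_of_nonsplit E v c hcδ hδ w hw).toField
  obtain ⟨Q, hQ⟩ := exists_eigenframe_of_charpoly_eq_prod g u hu hχ
  -- `P⁻¹ γ P = diag(u) = Q⁻¹ g Q`, so `g = (Q P⁻¹) γ (Q P⁻¹)⁻¹` is stably conjugate to `γ`
  have h1 : (P⁻¹ * γ * P).val = diagonal u := by
    rw [Units.val_mul, Units.val_mul, Matrix.mul_assoc, hP, ← Matrix.mul_assoc, ← Units.val_mul, inv_mul_cancel, Units.val_one,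
      Matrix.one_mul]
  have h2 : (Q⁻¹ * g * Q).val = diagonal u := by
    rw [Units.val_mul, Units.val_mul, Matrix.mul_assoc, hQ, ← Matrix.mul_assoc, ← Units.val_mul, inv_mul_cancel, Units.val_one,
      Matrix.one_mul]
  have h12 : P⁻¹ * γ * P = Q⁻¹ * g * Q := Units.ext (h1.trans h2.symm)
  have hk : Q * P⁻¹ * γ * (Q * P⁻¹)⁻¹ = g := by
    calc Q * P⁻¹ * γ * (Q * P⁻¹)⁻¹ = Q * (P⁻¹ * γ * P) * Q⁻¹ := by rw [_root_.mul_inv_rev, inv_inv]; simp only [mul_assoc]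
      _ = Q * (Q⁻¹ * g * Q) * Q⁻¹ := by rw [h12]
      _ = g := by group
  have hst : IsStablyConj (conjLocal E c v) H ⟨γ, hγ⟩ ⟨g, hg⟩ := isStablyConj_iff.2 ⟨Q * P⁻¹, hk⟩
  exact (isStablyConj_not_isConj_forall_of_not_normTest E v c hcδ hδ w hw hH hHd hγ hP hu hu1 hD hT).2.2 ⟨g, hg⟩ hst

end Generic

/-! ## §2 The literal algebra of `δ_1(a,c)`, `δ_ϖ(a,c)` at the split rank-2 form `Φ₂ = !![0, 1; 1, 0]` (generic commutative ring `R`, involution `σ`) -/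

section LiteralAlgebra

/-- `![a, b]` is injective when `a ≠ b`. [folklore] -/
private theorem injective_vec2 {α : Type*} {a b : α} (h : a ≠ b) : Function.Injective ![a, b] := by
  intro i j hij
  fin_cases i <;> fin_cases j
  · rfl
  · exact absurd (by simpa using hij) h
  · exact absurd (by simpa using hij.symm) h
  · rfl

variable {R : Type*} [CommRing R]

/-- **`Φ₂ = !![0, 1; 1, 0]` is `σ`-hermitian.** [cite: Rogawski1990, §4.9 p. 54] -/
theorem map_antidiagTwo_transpose (σ : R →+* R) :
    ((Matrix.of fun i j : Fin 2 => if i.val + j.val + 1 = 2 then (1 : R) else 0).map σ)ᵀ = (Matrix.of fun i j : Fin 2 => if i.val + j.val + 1 = 2 then (1 : R) else 0) := by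
  ext i j
  fin_cases i <;> fin_cases j <;> simp

/-- **`det Φ₂ = -1` is a unit.** [cite: Rogawski1990, §4.9 p. 54] -/
theorem isUnit_det_antidiagTwo : IsUnit (Matrix.of fun i j : Fin 2 => if i.val + j.val + 1 = 2 then (1 : R) else 0).det := by
  rw [Matrix.det_fin_two]
  simp

/-- **The eigenframe `P₀ = !![1, 1; -1, 1]` of `δ_1(a,c)` is invertible** (inverse `!![e, -e; e, e]`, `2e = 1`). [cite: Rogawski1990, §3.6 p. 31] -/
theorem exists_frame_val_eq {e : R} (h2e : 2 * e = 1) : ∃ P : GL (Fin 2) R, P.val = !![1, 1; -1, 1] :=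
  ⟨⟨!![1, 1; -1, 1], !![e, -e; e, e],
    by
      ext i j
      fin_cases i <;> fin_cases j <;> simp [Matrix.mul_apply, Fin.sum_univ_two] <;> linear_combination h2e,
    by
      ext i j
      fin_cases i <;> fin_cases j <;> simp [Matrix.mul_apply, Fin.sum_univ_two] <;> linear_combination h2e⟩, rfl⟩

/-- **The diagonal conjugator `D = diag(ϖ, 1)` is invertible** with `D⁻¹ = diag(ϖ′, 1)` whenever `ϖ ϖ′ = 1`. [cite: Rogawski1990, §3.6 p. 31] -/
theorem exists_diag_val_eq {ϖ ϖ' : R} (h : ϖ * ϖ' = 1) :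
    ∃ D : GL (Fin 2) R, D.val = diagonal ![ϖ, 1] ∧ (D⁻¹).val = diagonal ![ϖ', 1] :=
  ⟨⟨diagonal ![ϖ, 1], diagonal ![ϖ', 1],
    by rw [diagonal_mul_diagonal, ← diagonal_one]; congr 1; funext i; fin_cases i <;> simp [h],
    by rw [diagonal_mul_diagonal, ← diagonal_one]; congr 1; funext i; fin_cases i <;> simp [mul_comm ϖ', h]⟩, rfl, rfl⟩

variable (σ : R →+* R) {e a c : R}

/-- **`δ_1(a,c) · P₀ = P₀ · diag(a, c)`** — the columns `(1, −1)`, `(1, 1)` of `P₀` are eigenvectors of `δ_1(a,c) = !![e(a+c), −e(a−c); −e(a−c), e(a+c)]` for `a`, `c`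
(`2e = 1`). [cite: Rogawski1990, §3.6 p. 31] -/
theorem deltaOne_mul_frame (h2e : 2 * e = 1) {M : Matrix (Fin 2) (Fin 2) R} (hM : M = !![e * (a + c), -(e * (a - c)); -(e * (a - c)), e * (a + c)]) :
    M * !![1, 1; -1, 1] = !![1, 1; -1, 1] * diagonal ![a, c] := by
  subst hM
  ext i j
  fin_cases i <;> fin_cases j
  · simp [Matrix.mul_apply, Fin.sum_univ_two]; linear_combination a * h2e
  · simp [Matrix.mul_apply, Fin.sum_univ_two]; linear_combination c * h2e
  · simp [Matrix.mul_apply, Fin.sum_univ_two]; linear_combination (-a) * h2e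
  · simp [Matrix.mul_apply, Fin.sum_univ_two]; linear_combination c * h2e

/-- **`diag(ϖ, 1) · δ_1(a,c) · diag(ϖ′, 1) = δ_ϖ(a,c)`** `= !![e(a+c), −e(a−c)ϖ; −e(a−c)ϖ′, e(a+c)]` (`ϖ ϖ′ = 1`). [cite: Rogawski1990, §3.6 p. 31] [cite: Flicker1998UnitaryFL, §6 p. 95] -/
theorem diag_mul_deltaOne_mul_diag {ϖ ϖ' : R} (hϖϖ' : ϖ * ϖ' = 1) {M₁ M₂ : Matrix (Fin 2) (Fin 2) R}
    (hM₁ : M₁ = !![e * (a + c), -(e * (a - c)); -(e * (a - c)), e * (a + c)])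
    (hM₂ : M₂ = !![e * (a + c), -(e * (a - c) * ϖ); -(e * (a - c) * ϖ'), e * (a + c)]) :
    diagonal ![ϖ, 1] * M₁ * diagonal ![ϖ', 1] = M₂ := by
  subst hM₁ hM₂
  ext i j
  fin_cases i <;> fin_cases j
  · simp [Matrix.mul_apply, diagonal]; linear_combination (e * (a + c)) * hϖϖ'
  · simp [Matrix.mul_apply, diagonal]; ring
  · simp [Matrix.mul_apply, diagonal]
  · simp [Matrix.mul_apply, diagonal]

/-- **`⟨p₀, p₀⟩_{Φ₂} = −2`** for the first column `p₀ = (1, −1)` of `P₀`: `(H_{P₀})₀₀ = −2`. [cite: Rogawski1990, §3.5 p. 29] -/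
theorem twistGram_frame_zero_zero : twistGram σ (Matrix.of fun i j : Fin 2 => if i.val + j.val + 1 = 2 then (1 : R) else 0) !![1, 1; -1, 1] 0 0 = -2 := by
  simp [twistGram, Matrix.mul_apply, Fin.sum_univ_two]
  ring

/-- **`⟨D p₀, D p₀⟩_{Φ₂} = −2ϖ`** for `D = diag(ϖ, 1)`, `σ ϖ = ϖ`: `(H_{D P₀})₀₀ = −2ϖ`. [cite: Rogawski1990, §3.5 p. 29] -/
theorem twistGram_diag_mul_frame_zero_zero {ϖ : R} (hϖσ : σ ϖ = ϖ) :
    twistGram σ (Matrix.of fun i j : Fin 2 => if i.val + j.val + 1 = 2 then (1 : R) else 0) (diagonal ![ϖ, 1] * !![1, 1; -1, 1]) 0 0 = -(2 * ϖ) := by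
  simp [twistGram, Matrix.mul_apply, Fin.sum_univ_two, diagonal, hϖσ]
  ring

/-- **The norm test reads `ϖ ∈ N(R^×)`**: `−2ϖ = N(z)·(−2)` forces `ϖ = σ(z) z` (`2` is a unit: `2e = 1`). [cite: Rogawski1990, §3.5 Prop. 3.5.2 (c) p. 29] -/
theorem eq_norm_of_normTest (h2e : 2 * e = 1) {ϖ z : R} (h : -(2 * ϖ) = σ z * z * (-2)) : ϖ = σ z * z := by
  linear_combination (-(ϖ - σ z * z)) * h2e + (-e) * h

end LiteralAlgebra

/-! ## §3 THE HEADS at a non-split place: `δ_1(a,c)`, `δ_ϖ(a,c)` ARE the two `U(Φ₂)_v`-classes of the `G`-regular type-(1) stable class with eigenvalues `a ≠ c ∈ E¹_v` -/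

section Heads

variable {F : Type} (E : Type) [Field F] [NumberField F] [Field E] [NumberField E] [Algebra F E]
  [Algebra.IsQuadraticExtension F E] (v : HeightOneSpectrum (𝓞 F)) (τ : E ≃ₐ[F] E) {δ : E} (hτδ : τ δ = -δ) (hδ : δ ≠ 0)

omit [NumberField F] [Algebra.IsQuadraticExtension F E] in
/-- `E_v = ∏_{w ∣ v} E_w`: a unit times its pointwise inverse is `1`. [folklore] -/
private theorem mul_inv_eq_one_of_isUnit {x : LocalRing E v} (hx : IsUnit x) : x * x⁻¹ = 1 := by
  funext w'
  exact mul_inv_cancel₀ ((Pi.isUnit_iff.1 hx w').ne_zero)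

variable {e a c ϖ : LocalRing E v} {δ₁ δ₂ : GL (Fin 2) (LocalRing E v)}

include hτδ hδ in
/-- **CLASSIFY-C1, THE PAIR: `δ_1(a,c)` and `δ_ϖ(a,c)` are stably conjugate, NOT conjugate, and exhaust the stable class** in `U(Φ₂)(F_v)`, `Φ₂ = (Matrix.of fun i j : Fin 2 => if i.val + j.val + 1 = 2 then (1 : LocalRing E v) else 0)`, `v`
non-split, `a ≠ c` of norm one, `2e = 1`, `ϖ = σ ϖ` a unit of `E_v` which is NOT a norm `σ(z) z` (at an inert unramified `v`: any uniformiser of `F_v`, O'Meara 63:16 — supplied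
by the CM dress): `δ_ϖ = D δ_1 D⁻¹` with `D = diag(ϖ, 1)`; the `a`-eigenline `p₀ = (1, −1)` has `Φ₂`-length `−2` and `D p₀` has length `−2ϖ ∉ N(E_v^×)·(−2)`, so the ONE norm
test of ★ `exists_unitary_conj_iff_forall_normTest_iff_rankTwo` separates them, and ★ `exists_isStablyConj_not_isConj_forall_isConj_or_rankTwo` (two classes) makes them
exhaustive (§1).  Literals and memberships HYPOTHESIS-FIRST (typ1 (E1) v2.3 `hδ₁ hδ₂` bytes read in `E_v`). [cite: Rogawski1990, §3.5 Prop. 3.5.2 (c) p. 29; §3.6 p. 31]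
[cite: Flicker1998UnitaryFL, §6 p. 95] [cite: Omeara1963, §63C Example 63:16] -/
theorem isStablyConj_not_isConj_forall_deltaOne_deltaVarpi (w : PlacesOver E v) (hw : τ • w.1 = w.1)
    (h2e : 2 * e = 1) (ha : conjLocal E τ v a * a = 1) (hc : conjLocal E τ v c * c = 1) (hac : a ≠ c)
    (hϖσ : conjLocal E τ v ϖ = ϖ) (hϖu : IsUnit ϖ) (hϖN : ¬ ∃ z : LocalRing E v, IsUnit z ∧ ϖ = conjLocal E τ v z * z)
    (hδ₁U : δ₁ ∈ unitaryGroup (conjLocal E τ v) (Matrix.of fun i j : Fin 2 => if i.val + j.val + 1 = 2 then (1 : LocalRing E v) else 0)) (hδ₂U : δ₂ ∈ unitaryGroup (conjLocal E τ v) (Matrix.of fun i j : Fin 2 => if i.val + j.val + 1 = 2 then (1 : LocalRing E v) else 0))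
    (hδ₁ : δ₁.val = !![e * (a + c), -(e * (a - c)); -(e * (a - c)), e * (a + c)])
    (hδ₂ : δ₂.val = !![e * (a + c), -(e * (a - c) * ϖ); -(e * (a - c) * ϖ⁻¹), e * (a + c)]) :
    IsStablyConj (conjLocal E τ v) (Matrix.of fun i j : Fin 2 => if i.val + j.val + 1 = 2 then (1 : LocalRing E v) else 0) ⟨δ₁, hδ₁U⟩ ⟨δ₂, hδ₂U⟩ ∧
      ¬ IsConj (⟨δ₁, hδ₁U⟩ : unitaryGroup (conjLocal E τ v) (Matrix.of fun i j : Fin 2 => if i.val + j.val + 1 = 2 then (1 : LocalRing E v) else 0)) ⟨δ₂, hδ₂U⟩ ∧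
      ∀ δ' : unitaryGroup (conjLocal E τ v) (Matrix.of fun i j : Fin 2 => if i.val + j.val + 1 = 2 then (1 : LocalRing E v) else 0), IsStablyConj (conjLocal E τ v) (Matrix.of fun i j : Fin 2 => if i.val + j.val + 1 = 2 then (1 : LocalRing E v) else 0) ⟨δ₁, hδ₁U⟩ δ' →
        IsConj (⟨δ₁, hδ₁U⟩ : unitaryGroup (conjLocal E τ v) (Matrix.of fun i j : Fin 2 => if i.val + j.val + 1 = 2 then (1 : LocalRing E v) else 0)) δ' ∨
          IsConj (⟨δ₂, hδ₂U⟩ : unitaryGroup (conjLocal E τ v) (Matrix.of fun i j : Fin 2 => if i.val + j.val + 1 = 2 then (1 : LocalRing E v) else 0)) δ' := by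
  obtain ⟨P, hP⟩ := exists_frame_val_eq (R := LocalRing E v) h2e
  obtain ⟨D, hD1, hD2⟩ := exists_diag_val_eq (mul_inv_eq_one_of_isUnit E v hϖu)
  -- `δ₂ = D δ₁ D⁻¹`
  have hDδ : D * δ₁ * D⁻¹ = δ₂ :=
    Units.ext (by rw [Units.val_mul, Units.val_mul, hD1, hD2]; exact diag_mul_deltaOne_mul_diag (mul_inv_eq_one_of_isUnit E v hϖu) hδ₁ hδ₂)
  have hD : D * δ₁ * D⁻¹ ∈ unitaryGroup (conjLocal E τ v) (Matrix.of fun i j : Fin 2 => if i.val + j.val + 1 = 2 then (1 : LocalRing E v) else 0) := by rw [hDδ]; exact hδ₂U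
  -- the eigenframe of `δ₁`
  have hPδ : δ₁.val * P.val = P.val * diagonal ![a, c] := by rw [hP]; exact deltaOne_mul_frame h2e hδ₁
  -- the norm test fails on the transported `a`-eigenline
  have hT : ¬ ∃ z : LocalRing E v, IsUnit z ∧
      twistGram (conjLocal E τ v) (Matrix.of fun i j : Fin 2 => if i.val + j.val + 1 = 2 then (1 : LocalRing E v) else 0) (D.val * P.val) 0 0 = conjLocal E τ v z * z * twistGram (conjLocal E τ v) (Matrix.of fun i j : Fin 2 => if i.val + j.val + 1 = 2 then (1 : LocalRing E v) else 0) P.val 0 0 := by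
    rintro ⟨z, hz, h⟩
    rw [hD1, hP, twistGram_diag_mul_frame_zero_zero (conjLocal E τ v) hϖσ, twistGram_frame_zero_zero] at h
    exact hϖN ⟨z, hz, eq_norm_of_normTest (conjLocal E τ v) h2e h⟩
  have hu1 : ∀ i, conjLocal E τ v (![a, c] i) * ![a, c] i = 1 := fun i => by fin_cases i <;> simpa
  have key := isStablyConj_not_isConj_forall_of_not_normTest E v τ hτδ hδ w hw (map_antidiagTwo_transpose (conjLocal E τ v))
    isUnit_det_antidiagTwo hδ₁U hPδ (injective_vec2 hac) hu1 hD hT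
  have heq : (⟨D * δ₁ * D⁻¹, hD⟩ : unitaryGroup (conjLocal E τ v) (Matrix.of fun i j : Fin 2 => if i.val + j.val + 1 = 2 then (1 : LocalRing E v) else 0)) = ⟨δ₂, hδ₂U⟩ := Subtype.ext hDδ
  rw [heq] at key
  exact key

include hτδ hδ in
/-- **CLASSIFY-C1, HEAD (ELL-1): every `g ∈ U(Φ₂)(F_v)` with `χ_g = (X − a)(X − c)`, `a ≠ c ∈ E¹_v`, is conjugate IN `U(Φ₂)(F_v)` to `δ_1(a,c)` or to `δ_ϖ(a,c)`**
(hypotheses as in `isStablyConj_not_isConj_forall_deltaOne_deltaVarpi`; `G`-regularity of `(g, b) ∈ H_v` only adds `b ∉ {a, c}` and is not needed for the `U(Φ₂)`-cell).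
[cite: Rogawski1990, §3.5 Prop. 3.5.2 (c) p. 29; §3.6 p. 31] [cite: Flicker1998UnitaryFL, §6 p. 95] [cite: HornJohnson2013, 3.3.P12] -/
theorem isConj_deltaOne_or_deltaVarpi_of_charpoly (w : PlacesOver E v) (hw : τ • w.1 = w.1)
    (h2e : 2 * e = 1) (ha : conjLocal E τ v a * a = 1) (hc : conjLocal E τ v c * c = 1) (hac : a ≠ c)
    (hϖσ : conjLocal E τ v ϖ = ϖ) (hϖu : IsUnit ϖ) (hϖN : ¬ ∃ z : LocalRing E v, IsUnit z ∧ ϖ = conjLocal E τ v z * z)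
    (hδ₁U : δ₁ ∈ unitaryGroup (conjLocal E τ v) (Matrix.of fun i j : Fin 2 => if i.val + j.val + 1 = 2 then (1 : LocalRing E v) else 0)) (hδ₂U : δ₂ ∈ unitaryGroup (conjLocal E τ v) (Matrix.of fun i j : Fin 2 => if i.val + j.val + 1 = 2 then (1 : LocalRing E v) else 0))
    (hδ₁ : δ₁.val = !![e * (a + c), -(e * (a - c)); -(e * (a - c)), e * (a + c)])
    (hδ₂ : δ₂.val = !![e * (a + c), -(e * (a - c) * ϖ); -(e * (a - c) * ϖ⁻¹), e * (a + c)])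
    {g : GL (Fin 2) (LocalRing E v)} (hg : g ∈ unitaryGroup (conjLocal E τ v) (Matrix.of fun i j : Fin 2 => if i.val + j.val + 1 = 2 then (1 : LocalRing E v) else 0)) (hχ : g.val.charpoly = (X - C a) * (X - C c)) :
    IsConj (⟨δ₁, hδ₁U⟩ : unitaryGroup (conjLocal E τ v) (Matrix.of fun i j : Fin 2 => if i.val + j.val + 1 = 2 then (1 : LocalRing E v) else 0)) ⟨g, hg⟩ ∨
      IsConj (⟨δ₂, hδ₂U⟩ : unitaryGroup (conjLocal E τ v) (Matrix.of fun i j : Fin 2 => if i.val + j.val + 1 = 2 then (1 : LocalRing E v) else 0)) ⟨g, hg⟩ := by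
  letI : Field (LocalRing E v) :=
    (Liu2021.LemD1IndexedNonVacuityNonsplitPlace.isField_localRing_of_nonsplit E v τ hτδ hδ w hw).toField
  have hχ' : g.val.charpoly = ∏ i, (X - C (![a, c] i)) := by rw [hχ, Fin.prod_univ_two]; simp
  obtain ⟨Q, hQ⟩ := exists_eigenframe_of_charpoly_eq_prod g ![a, c] (injective_vec2 hac) hχ'
  -- `g` is stably conjugate to `δ₁` (two eigenframes for the same `diag(a, c)`)
  obtain ⟨P, hP⟩ := exists_frame_val_eq (R := LocalRing E v) h2e
  have hPδ : δ₁.val * P.val = P.val * diagonal ![a, c] := by rw [hP]; exact deltaOne_mul_frame h2e hδ₁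
  have h1 : (P⁻¹ * δ₁ * P).val = diagonal ![a, c] := by
    rw [Units.val_mul, Units.val_mul, Matrix.mul_assoc, hPδ, ← Matrix.mul_assoc, ← Units.val_mul, inv_mul_cancel, Units.val_one, Matrix.one_mul]
  have h2 : (Q⁻¹ * g * Q).val = diagonal ![a, c] := by
    rw [Units.val_mul, Units.val_mul, Matrix.mul_assoc, hQ, ← Matrix.mul_assoc, ← Units.val_mul, inv_mul_cancel, Units.val_one, Matrix.one_mul]
  have h12 : P⁻¹ * δ₁ * P = Q⁻¹ * g * Q := Units.ext (h1.trans h2.symm)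
  have hk : Q * P⁻¹ * δ₁ * (Q * P⁻¹)⁻¹ = g := by
    calc Q * P⁻¹ * δ₁ * (Q * P⁻¹)⁻¹ = Q * (P⁻¹ * δ₁ * P) * Q⁻¹ := by rw [_root_.mul_inv_rev, inv_inv]; simp only [mul_assoc]
      _ = Q * (Q⁻¹ * g * Q) * Q⁻¹ := by rw [h12]
      _ = g := by group
  have hst : IsStablyConj (conjLocal E τ v) (Matrix.of fun i j : Fin 2 => if i.val + j.val + 1 = 2 then (1 : LocalRing E v) else 0) ⟨δ₁, hδ₁U⟩ ⟨g, hg⟩ := isStablyConj_iff.2 ⟨Q * P⁻¹, hk⟩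
  exact (isStablyConj_not_isConj_forall_deltaOne_deltaVarpi E v τ hτδ hδ w hw h2e ha hc hac hϖσ hϖu hϖN hδ₁U hδ₂U hδ₁ hδ₂).2.2 ⟨g, hg⟩ hst

include hτδ hδ in
/-- **CLASSIFY-C1, HEAD (ELL-1) IN CONJUGATOR FORM** (spec authority (P2): the CM dress transports a `GL₂(E_v)`-conjugator lying in `U(Φ₂)(F_v)`, no `IsConj`-on-subtype at the
seam): under the same hypotheses there is `h ∈ U(Φ₂)(F_v)` with `h g h⁻¹ = δ_1(a,c)` or `h g h⁻¹ = δ_ϖ(a,c)`. [cite: Rogawski1990, §3.5 Prop. 3.5.2 (c) p. 29; §3.6 p. 31]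
[cite: Flicker1998UnitaryFL, §6 p. 95] -/
theorem exists_mem_conj_eq_deltaOne_or_deltaVarpi_of_charpoly (w : PlacesOver E v) (hw : τ • w.1 = w.1)
    (h2e : 2 * e = 1) (ha : conjLocal E τ v a * a = 1) (hc : conjLocal E τ v c * c = 1) (hac : a ≠ c)
    (hϖσ : conjLocal E τ v ϖ = ϖ) (hϖu : IsUnit ϖ) (hϖN : ¬ ∃ z : LocalRing E v, IsUnit z ∧ ϖ = conjLocal E τ v z * z)
    (hδ₁U : δ₁ ∈ unitaryGroup (conjLocal E τ v) (Matrix.of fun i j : Fin 2 => if i.val + j.val + 1 = 2 then (1 : LocalRing E v) else 0)) (hδ₂U : δ₂ ∈ unitaryGroup (conjLocal E τ v) (Matrix.of fun i j : Fin 2 => if i.val + j.val + 1 = 2 then (1 : LocalRing E v) else 0))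
    (hδ₁ : δ₁.val = !![e * (a + c), -(e * (a - c)); -(e * (a - c)), e * (a + c)])
    (hδ₂ : δ₂.val = !![e * (a + c), -(e * (a - c) * ϖ); -(e * (a - c) * ϖ⁻¹), e * (a + c)])
    {g : GL (Fin 2) (LocalRing E v)} (hg : g ∈ unitaryGroup (conjLocal E τ v) (Matrix.of fun i j : Fin 2 => if i.val + j.val + 1 = 2 then (1 : LocalRing E v) else 0)) (hχ : g.val.charpoly = (X - C a) * (X - C c)) :
    ∃ h ∈ unitaryGroup (conjLocal E τ v) (Matrix.of fun i j : Fin 2 => if i.val + j.val + 1 = 2 then (1 : LocalRing E v) else 0), h * g * h⁻¹ = δ₁ ∨ h * g * h⁻¹ = δ₂ := by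
  rcases isConj_deltaOne_or_deltaVarpi_of_charpoly E v τ hτδ hδ w hw h2e ha hc hac hϖσ hϖu hϖN hδ₁U hδ₂U hδ₁ hδ₂ hg hχ with h | h
  · obtain ⟨k, hk⟩ := isConj_iff.1 h
    have hk' : (k : GL (Fin 2) (LocalRing E v)) * δ₁ * (k : GL (Fin 2) (LocalRing E v))⁻¹ = g := by simpa using congrArg Subtype.val hk
    refine ⟨((k⁻¹ : unitaryGroup (conjLocal E τ v) (Matrix.of fun i j : Fin 2 => if i.val + j.val + 1 = 2 then (1 : LocalRing E v) else 0)) : GL (Fin 2) (LocalRing E v)), (k⁻¹).2, Or.inl ?_⟩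
    rw [Subgroup.coe_inv, ← hk']
    group
  · obtain ⟨k, hk⟩ := isConj_iff.1 h
    have hk' : (k : GL (Fin 2) (LocalRing E v)) * δ₂ * (k : GL (Fin 2) (LocalRing E v))⁻¹ = g := by simpa using congrArg Subtype.val hk
    refine ⟨((k⁻¹ : unitaryGroup (conjLocal E τ v) (Matrix.of fun i j : Fin 2 => if i.val + j.val + 1 = 2 then (1 : LocalRing E v) else 0)) : GL (Fin 2) (LocalRing E v)), (k⁻¹).2, Or.inr ?_⟩
    rw [Subgroup.coe_inv, ← hk']
    group

end Heads

end Summit.HodgeConjecture.HodgeConjecture.R90.S6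

end
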